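import Literature.Algebra.EuclideanLattices.MRIncGDDSolver
import Literature.Algebra.EuclideanLattices.MRShortVectorsIteration
import Literature.Probability.Distributions.FirstSuccessBlocks
import Literature.Probability.Distributions.KernelIteration
import HarnessLib

/-!
# The loop of Micciancio–Regev 2007, Lemma 5.10 over the amplified idealised solver: the idealised Cor. 5.13 (`GIVP ← SIS`) — proved

Topic `Algebra/EuclideanLattices` (family `pqc`). The mathematics of MR07 Cor. 5.13 ("a probabilistic
polynomial time reduction from solving `GIVP^{η_ε}_γ` in the worst case with `γ(n) = 8β(n)√n` to
solving `SIS_{q,m,β}` on the average", p. 25 = Lemma 5.10 + Thm. 5.9), with the reduction written as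
a `PMF` process and its success probability bounded explicitly — what a bit-level proof of the first
step of Thm. 5.23 ("using Corollary 5.13 (with `F` as an oracle), we obtain … `S`", p. 29; the one
hypothesis of `GapSVPFromGIVP.owfExist_of_gapSVP_worstCaseHard_of_givpDual`) must mirror:

* `solveAmp` — `k₀` independent runs of the solver of `MRIncGDDSolver.lean`, first verified answer
  (`solveAmp_apply_none`: fails with probability `Pr[solve fails]^{k₀}`, `FirstSuccessBlocks`);
* `loopStep` — one round of Lemma 5.10 on states `(round counter, running?, S)`: pick a longest
  `sᵢ` (`longest`), the target `t ⊥ {sⱼ}ⱼ≠ᵢ` of length `‖S‖/2` (`roundTarget`,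
  `MRShortVectorsIteration.exists_orthogonal_norm_eq`), the grid denominator (`gridDenom`,
  `MRFineGridChoice.exists_nsmul_mem_span`), call `solveAmp` on `(Λ, S, t, ‖S‖/8)` with verification
  radius `n√mβ‖S‖/q + ‖S‖/8 ≤ ‖S‖/4` (`q ≥ 8n√m β`), replace `sᵢ` by the answer or stop;
* `goodState` — running with independent `S` and potential `∏‖sⱼ‖ ≤ (3/4)^k ∏‖s₀ⱼ‖`, or stopped
  with an independent SHORT `S` (`‖sⱼ‖ ≤ 8β√n η_ε(Λ)`);
* `toReal_loopStep_compl_goodState_le` — each round leaves the good states with probability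
  `≤ (1 − p)^{k₀}`, `p = (δ/(2βm) − m·2ε/(1+ε))/3` (`shortening_step` when the solver answers; the
  solver bound when the `IncGDD` promise `‖S‖ ≥ 8β√n η_ε` holds; nothing to lose when it fails);
* **`toReal_iterate_loopStep_short_ge`** — after `T + 1` rounds with `(3/4)^{T+1} ∏‖s₀ⱼ‖ < λⁿ`
  (`λ ≤ ‖v‖` on `Λ ∖ 0`), the state is stopped with a linearly independent `S ⊂ Λ`,
  `‖sⱼ‖ ≤ 8β√n η_ε(Λ)`, except with probability `≤ (T+1)(1 − p)^{k₀}` (`KernelIteration`); i.e. the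
  process solves `GIVP^{η_ε}_{8β√n}` with probability `≥ 2/3` once `k₀`, `T` are polynomially large
  (`δ ≥ 1/nᶜ`, `ε = 2⁻ⁿ`).

## References

* D. Micciancio, O. Regev, *Worst-case to average-case reductions based on Gaussian measures*,
  SIAM J. Comput. 37 (2007) 267–302; authors' version (`lit read doi:10.1137/S0097539705447360`),
  Lemma 5.10 (p. 24), Cor. 5.13 (p. 25), Thm. 5.23 (proof, first step, p. 29).
-/

noncomputable section

open Finset Module Submodule

namespace Literature.Algebra.EuclideanLattices

namespace MicciancioRegev2007

/-! ## The loop of MR07 Lemma 5.10 with the amplified idealised solver: the idealised Cor. 5.13 -/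

section Loop

open scoped ENNReal Classical Real
open MeasureTheory PMF Literature.Probability.Distributions Literature.Computability.Cryptography
  Literature.Computability.Cryptography.SIS

variable {V : Type*} [NormedAddCommGroup V] [InnerProductSpace ℝ V] [FiniteDimensional ℝ V]
  [MeasurableSpace V] [BorelSpace V]
variable (Λ : Submodule ℤ V) [DiscreteTopology Λ] [IsZLattice ℝ Λ]
variable {n : ℕ} [NeZero n] (hn : n = finrank ℝ V)
variable (q : ℕ) [NeZero q]
variable {m : ℕ} (O : Matrix (Fin n) (Fin m) (ZMod q) → PMF (Fin m → ℤ))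

/-! ### Amplification of the solver -/

/-- **The amplified solver**: `k₀` independent runs of `solve`, first verified success.
[cite: MicciancioRegev2007, Lemma 5.10 with Thm. 5.9 (a probabilistic IncGDD oracle is called until it answers)] -/
def solveAmp (S : Fin n → Λ) (hS : LinearIndependent ℝ fun j => (S j : V)) (d : ℕ) [NeZero d]
    (t : V) (r R β : ℝ) (gs : List (Fin m × ℤ)) (k₀ : ℕ) : PMF (Option Λ) :=
  (indepLaw k₀ fun _ => solve Λ S hS hn q d O t r R β gs).map fun v => (List.ofFn v).findSome? id

omit [NeZero n] [MeasurableSpace V] [BorelSpace V] [IsZLattice ℝ Λ] in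
/-- The amplified solver fails iff all runs fail: `Pr[none] = Pr[solve = none]^{k₀}`. [folklore] -/
theorem solveAmp_apply_none (S : Fin n → Λ) (hS : LinearIndependent ℝ fun j => (S j : V)) (d : ℕ)
    [NeZero d] (t : V) (r R β : ℝ) (gs : List (Fin m × ℤ)) (k₀ : ℕ) :
    solveAmp Λ hn q O S hS d t r R β gs k₀ none = (solve Λ S hS hn q d O t r R β gs none) ^ k₀ :=
  indepLaw_map_findSome_apply_none _ k₀

omit [NeZero n] [MeasurableSpace V] [BorelSpace V] [IsZLattice ℝ Λ] in
/-- A verified output of the amplified solver is within `R` of the target. [folklore] -/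
theorem norm_sub_le_of_mem_support_solveAmp (S : Fin n → Λ) (hS : LinearIndependent ℝ fun j => (S j : V))
    (d : ℕ) [NeZero d] (t : V) (r R β : ℝ) (gs : List (Fin m × ℤ)) (k₀ : ℕ) {u : Λ}
    (hu : some u ∈ (solveAmp Λ hn q O S hS d t r R β gs k₀).support) : ‖(u : V) - t‖ ≤ R := by
  rw [solveAmp, PMF.support_map] at hu
  obtain ⟨v, hv, hvu⟩ := hu
  obtain ⟨o, ho, hou⟩ := List.exists_of_findSome?_eq_some hvu
  rw [List.mem_ofFn] at ho
  obtain ⟨k, rfl⟩ := ho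
  simp only [id] at hou
  have hk : v k ∈ (solve Λ S hS hn q d O t r R β gs).support :=
    mem_support_of_mem_support_indepLaw hv k
  rw [hou] at hk
  exact norm_sub_le_of_mem_support_solve Λ S hS hn q d O t r R β gs hk

/-! ### One round of Lemma 5.10 -/

/-- The index of a longest vector of `S` (`‖S‖ = ‖s_i‖`). [cite: MicciancioRegev2007, Lemma 5.10 (proof: "we identify the longest vector in S, say sᵢ")] -/
def longest (S : Fin n → Λ) : Fin n :=
  Classical.choose (exists_eq_ciSup_of_finite (ι := Fin n) (α := ℝ) (f := fun j => ‖(S j : V)‖))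

omit [InnerProductSpace ℝ V] [FiniteDimensional ℝ V] [MeasurableSpace V] [BorelSpace V]
  [DiscreteTopology Λ] [IsZLattice ℝ Λ] in
/-- Every vector of `S` is at most as long as the chosen longest one. [folklore] -/
theorem norm_le_norm_longest [NormedSpace ℝ V] (S : Fin n → Λ) (j : Fin n) :
    ‖(S j : V)‖ ≤ ‖(S (longest Λ S) : V)‖ := by
  have h := Classical.choose_spec (exists_eq_ciSup_of_finite (ι := Fin n) (α := ℝ) (f := fun j => ‖(S j : V)‖))
  change ‖(S (longest Λ S) : V)‖ = ⨆ j, ‖(S j : V)‖ at h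
  rw [h]
  exact le_ciSup (Set.finite_range fun j => ‖(S j : V)‖).bddAbove j

/-- The grid denominator for `S`: some `d ≥ 1` with `d • Λ ⊆ L(S)` (`MRFineGridChoice.exists_nsmul_mem_span`).
[folklore] -/
def gridDenom (S : Fin n → Λ) (hS : LinearIndependent ℝ fun j => (S j : V)) : ℕ :=
  Classical.choose (exists_nsmul_mem_span Λ S hS hn)

omit [MeasurableSpace V] [BorelSpace V] [NeZero n] in
/-- The defining property of `gridDenom`. [folklore] -/
theorem gridDenom_spec (S : Fin n → Λ) (hS : LinearIndependent ℝ fun j => (S j : V)) :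
    gridDenom Λ hn S hS ≠ 0 ∧ ∀ x : Λ, gridDenom Λ hn S hS • x ∈ span ℤ (Set.range S) :=
  Classical.choose_spec (exists_nsmul_mem_span Λ S hS hn)

/-- The target of the round: a vector orthogonal to the other `sⱼ` of length `‖S‖/2`
(`MRShortVectorsIteration.exists_orthogonal_norm_eq`). [cite: MicciancioRegev2007, Lemma 5.10 (proof: "we take t to be a vector orthogonal to s₁,…,sᵢ₋₁,sᵢ₊₁,…,sₙ of length ‖S‖/2")] -/
def roundTarget (S : Fin n → Λ) (hS : LinearIndependent ℝ fun j => (S j : V)) : V :=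
  Classical.choose (exists_orthogonal_norm_eq hS (longest Λ S)
    (r := ‖(S (longest Λ S) : V)‖ / 2) (by positivity))

omit [MeasurableSpace V] [BorelSpace V] [DiscreteTopology Λ] [IsZLattice ℝ Λ] in
/-- The defining properties of `roundTarget`. [folklore] -/
theorem roundTarget_spec (S : Fin n → Λ) (hS : LinearIndependent ℝ fun j => (S j : V)) :
    roundTarget Λ S hS ∈ (span ℝ ((fun j => (S j : V)) '' {longest Λ S}ᶜ))ᗮ ∧
      ‖roundTarget Λ S hS‖ = ‖(S (longest Λ S) : V)‖ / 2 :=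
  Classical.choose_spec (exists_orthogonal_norm_eq hS (longest Λ S)
    (r := ‖(S (longest Λ S) : V)‖ / 2) (by positivity))

/-- **One round of MR07 Lemma 5.10 with the amplified idealised solver**, on states
`(round counter, running?, S)`: a stopped state only advances the counter; a running state with
linearly independent `S` calls the amplified solver on `(Λ, S, t, ‖S‖/8)` with the verification
radius `n√m β‖S‖/q + ‖S‖/8` and either replaces the longest vector by the answer or stops; a
running state with dependent `S` (never reached) stops.
[cite: MicciancioRegev2007, Lemma 5.10 (proof, p. 24)] -/
def loopStep (β : ℝ) (k₀ : ℕ) : ℕ × Bool × (Fin n → Λ) → PMF (ℕ × Bool × (Fin n → Λ))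
  | (k, false, S) => PMF.pure (k + 1, false, S)
  | (k, true, S) =>
    if hS : LinearIndependent ℝ fun j => (S j : V) then
      haveI : NeZero (gridDenom Λ hn S hS) := ⟨(gridDenom_spec Λ hn S hS).1⟩
      (solveAmp Λ hn q O S hS (gridDenom Λ hn S hS) (roundTarget Λ S hS)
          (‖(S (longest Λ S) : V)‖ / 8)
          (n * Real.sqrt m * β * ‖(S (longest Λ S) : V)‖ / q + ‖(S (longest Λ S) : V)‖ / 8) β
          (guessList m ⌊β⌋₊) k₀).map
        fun o => o.elim (k + 1, false, S) fun u => (k + 1, true, Function.update S (longest Λ S) u)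
    else PMF.pure (k + 1, false, S)

omit [MeasurableSpace V] [BorelSpace V] in
/-- A stopped state only advances the counter. [folklore] -/
theorem loopStep_stopped (β : ℝ) (k₀ k : ℕ) (S : Fin n → Λ) :
    loopStep Λ hn q O β k₀ (k, false, S) = PMF.pure (k + 1, false, S) := rfl

omit [MeasurableSpace V] [BorelSpace V] in
/-- A running state with linearly independent `S` calls the amplified solver. [folklore] -/
theorem loopStep_running (β : ℝ) (k₀ k : ℕ) (S : Fin n → Λ) (hS : LinearIndependent ℝ fun j => (S j : V)) :
    loopStep Λ hn q O β k₀ (k, true, S) =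
      (haveI : NeZero (gridDenom Λ hn S hS) := ⟨(gridDenom_spec Λ hn S hS).1⟩
      (solveAmp Λ hn q O S hS (gridDenom Λ hn S hS) (roundTarget Λ S hS)
          (‖(S (longest Λ S) : V)‖ / 8)
          (n * Real.sqrt m * β * ‖(S (longest Λ S) : V)‖ / q + ‖(S (longest Λ S) : V)‖ / 8) β
          (guessList m ⌊β⌋₊) k₀).map
        fun o => o.elim (k + 1, false, S) fun u => (k + 1, true, Function.update S (longest Λ S) u)) := by
  unfold loopStep
  exact dif_pos hS

omit [MeasurableSpace V] [BorelSpace V] in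
/-- A running state with dependent `S` (never reached from a good start) stops. [folklore] -/
theorem loopStep_running_of_not (β : ℝ) (k₀ k : ℕ) (S : Fin n → Λ)
    (hS : ¬ LinearIndependent ℝ fun j => (S j : V)) :
    loopStep Λ hn q O β k₀ (k, true, S) = PMF.pure (k + 1, false, S) := by
  unfold loopStep
  exact dif_neg hS

/-- **The good states**: running with linearly independent `S` whose potential `∏ⱼ ‖sⱼ‖` has dropped
by `(3/4)^k` after `k` rounds, or stopped with a linearly independent SHORT set
(`‖sⱼ‖ ≤ 8β√n η_ε(Λ)`, the `GIVP_{8β√n}^{η_ε}` goal of Cor. 5.13).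
[cite: MicciancioRegev2007, Lemma 5.10 (proof) and Cor. 5.13] -/
def goodState (β ε P₀ : ℝ) : Set (ℕ × Bool × (Fin n → Λ)) :=
  {st | (st.2.1 = true ∧ LinearIndependent ℝ (fun j => (st.2.2 j : V)) ∧
        ∏ j, ‖(st.2.2 j : V)‖ ≤ (3 / 4 : ℝ) ^ st.1 * P₀) ∨
      (st.2.1 = false ∧ LinearIndependent ℝ (fun j => (st.2.2 j : V)) ∧
        ∀ j, ‖(st.2.2 j : V)‖ ≤ 8 * β * Real.sqrt (finrank ℝ V) * smoothingParameter Λ ε)}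

/-! ### The per-round failure bound -/

/-- **Each round leaves the good states with probability at most `(1 − p)^{k₀}`**,
`p = (δ/(2βm) − m·2ε/(1+ε))/3`: from a stopped or short running state never; from a running state
with `‖S‖ ≥ 8β√n η_ε(Λ)` (the `IncGDD` promise at `r = ‖S‖/8`) only if all `k₀` solver runs fail
(a verified answer keeps independence and shrinks the potential by `3/4`, `shortening_step`; this
needs `q ≥ 8n√m β` so that the verification radius is `≤ ‖S‖/4`).
[cite: MicciancioRegev2007, Lemma 5.10 (proof) with Thm. 5.9] -/
theorem toReal_loopStep_compl_goodState_le {ε β P₀ : ℝ} (hε : 0 < ε) (hε1 : ε < 1) (hβ : 1 ≤ β)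
    (hm : 0 < m) (hn1 : 1 ≤ finrank ℝ V) (hq : 8 * n * Real.sqrt m * β ≤ q)
    (hnum : 1 / (2 * π) + ε / (1 - ε) + (ε / (1 - ε)) ^ 2 * m ≤ 1 / 6) (k₀ : ℕ)
    {p : ℝ} (hp : p = (1 / 3 : ℝ) *
        ((((PMF.uniformOfFintype (Matrix (Fin n) (Fin m) (ZMod q))).bind fun A =>
            (O A).map (Prod.mk A)).toOuterMeasure {az | IsSolution az.1 β az.2}).toReal / (2 * β * m) -
          m * (2 * ε / (1 + ε))))
    (st : ℕ × Bool × (Fin n → Λ)) (hst : st ∈ goodState Λ β ε P₀) :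
    (((loopStep Λ hn q O β k₀) st).toOuterMeasure (goodState Λ β ε P₀)ᶜ).toReal ≤ (1 - p) ^ k₀ := by
  obtain ⟨k, flag, S⟩ := st
  have hβ0 : 0 < β := by linarith
  have hm0 : (0 : ℝ) < m := by exact_mod_cast hm
  have hp1 : p ≤ 1 / 3 := by
    rw [hp]
    have h1 : (((PMF.uniformOfFintype (Matrix (Fin n) (Fin m) (ZMod q))).bind fun A =>
        (O A).map (Prod.mk A)).toOuterMeasure {az | IsSolution az.1 β az.2}).toReal ≤ 1 :=
      PMF.toReal_toOuterMeasure_le_one _ _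
    have h2 : 0 ≤ (m : ℝ) * (2 * ε / (1 + ε)) := by positivity
    have h3 : (((PMF.uniformOfFintype (Matrix (Fin n) (Fin m) (ZMod q))).bind fun A =>
        (O A).map (Prod.mk A)).toOuterMeasure {az | IsSolution az.1 β az.2}).toReal / (2 * β * m) ≤ 1 := by
      rw [div_le_one (by positivity)]
      have : (1 : ℝ) ≤ m := by exact_mod_cast hm
      nlinarith
    nlinarith
  have hη0 : 0 ≤ (1 - p) ^ k₀ := pow_nonneg (by linarith) _
  rcases hst with ⟨hflag, hS, hpot⟩ | ⟨hflag, hS, hshort⟩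
  · -- running, linearly independent
    dsimp only at hflag hS hpot
    subst hflag
    haveI : NeZero (gridDenom Λ hn S hS) := ⟨(gridDenom_spec Λ hn S hS).1⟩
    rw [loopStep_running Λ hn q O β k₀ k S hS, PMF.toOuterMeasure_map_apply]
    set i := longest Λ S with hi
    set M : ℝ := ‖(S i : V)‖ with hM
    have hM0 : 0 < M := norm_pos_iff.2 (by
      have := hS.ne_zero i
      exact fun h => this h)
    set A := solveAmp Λ hn q O S hS (gridDenom Λ hn S hS) (roundTarget Λ S hS) (M / 8)
      (n * Real.sqrt m * β * M / q + M / 8) β (guessList m ⌊β⌋₊) k₀ with hA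
    -- the verification radius is at most `‖S‖/4`
    have hR : n * Real.sqrt m * β * M / q + M / 8 ≤ M / 4 := by
      have hq0 : (0 : ℝ) < q := by
        have : (0 : ℝ) < 8 * n * Real.sqrt m * β := by
          have : (1 : ℝ) ≤ n := by
            have := NeZero.ne n; exact_mod_cast Nat.one_le_iff_ne_zero.2 this
          have : (0 : ℝ) < Real.sqrt m := Real.sqrt_pos.2 (by exact_mod_cast hm)
          positivity
        linarith
      have h1 : n * Real.sqrt m * β * M / q ≤ M / 8 := by
        rw [div_le_div_iff₀ hq0 (by norm_num)]
        nlinarith [mul_le_mul_of_nonneg_right hq hM0.le]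
      linarith
    -- a verified answer gives a good running state
    have hsome : ∀ u : Λ, some u ∈ A.support →
        (k + 1, true, Function.update S i u) ∈ goodState Λ β ε P₀ := by
      intro u hu
      have hut : ‖(u : V) - roundTarget Λ S hS‖ ≤ M / 4 :=
        (norm_sub_le_of_mem_support_solveAmp Λ hn q O S hS _ _ _ _ β _ k₀ hu).trans hR
      obtain ⟨ht, htn⟩ := roundTarget_spec Λ S hS
      have hstep := shortening_step hS (i := i) (norm_le_norm_longest Λ S) ht htn hut
      refine Or.inl ⟨rfl, ?_, ?_⟩
      · convert hstep.1 using 1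
        funext j
        by_cases hj : j = i
        · rw [hj]; simp
        · simp [Function.update_of_ne hj]
      · have hprod : ∏ j, ‖((Function.update S i u j : Λ) : V)‖ =
            ∏ j, ‖Function.update (fun j => (S j : V)) i (u : V) j‖ :=
          Finset.prod_congr rfl fun j _ => by
            by_cases hj : j = i
            · rw [hj]; simp
            · simp [Function.update_of_ne hj]
        rw [hprod]
        calc ∏ j, ‖Function.update (fun j => (S j : V)) i (u : V) j‖
            ≤ 3 / 4 * ∏ j, ‖(S j : V)‖ := hstep.2.2.2
          _ ≤ 3 / 4 * ((3 / 4 : ℝ) ^ k * P₀) := by gcongr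
          _ = (3 / 4 : ℝ) ^ (k + 1) * P₀ := by ring
    by_cases hprom : 8 * β * Real.sqrt (finrank ℝ V) * smoothingParameter Λ ε ≤ M
    · -- the promise holds: only `none` is bad, and it has probability ≤ (1 - p)^k₀
      have hsub : ((fun o : Option Λ => o.elim (k + 1, false, S) fun u =>
          (k + 1, true, Function.update S i u)) ⁻¹' (goodState Λ β ε P₀)ᶜ) ∩ A.support ⊆ {none} := by
        rintro (_ | u) ⟨ho, hsupp⟩
        · rfl
        · exact (ho (hsome u hsupp)).elim
      refine (ENNReal.toReal_mono (PMF.toOuterMeasure_ne_top _ _) (A.toOuterMeasure_mono hsub)).trans ?_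
      rw [PMF.toOuterMeasure_apply_singleton, hA, solveAmp_apply_none, ENNReal.toReal_pow]
      refine pow_le_pow_left₀ ENNReal.toReal_nonneg ?_ k₀
      -- the solver bound for this state
      have hβ0 : 0 < β := by linarith
      have hr : 0 < M / 8 := by positivity
      have hηs : 2 * smoothingParameter Λ ε ≤ 2 * (M / 8) / (β * Real.sqrt (finrank ℝ V)) := by
        have hsq : 0 < Real.sqrt (finrank ℝ V) := Real.sqrt_pos.2 (by exact_mod_cast hn1)
        rw [le_div_iff₀ (by positivity)]
        nlinarith
      have h := toReal_solve_none_le Λ S hS hn q (gridDenom Λ hn S hS) O (gridDenom_spec Λ hn S hS).2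
        hε hε1 hβ hr hn1 hm hηs (σ := M) (norm_le_norm_longest Λ S) (roundTarget Λ S hS) hnum
      rw [hp]
      convert h using 2
    · -- the promise fails: stopping is good too, nothing is bad
      push Not at hprom
      have hsub : ((fun o : Option Λ => o.elim (k + 1, false, S) fun u =>
          (k + 1, true, Function.update S i u)) ⁻¹' (goodState Λ β ε P₀)ᶜ) ∩ A.support ⊆ ∅ := by
        rintro (_ | u) ⟨ho, hsupp⟩
        · refine (ho (Or.inr ⟨rfl, hS, fun j => ?_⟩)).elim
          exact (norm_le_norm_longest Λ S j).trans hprom.le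
        · exact (ho (hsome u hsupp)).elim
      refine (ENNReal.toReal_mono (PMF.toOuterMeasure_ne_top _ _) (A.toOuterMeasure_mono hsub)).trans ?_
      rw [MeasureTheory.measure_empty, ENNReal.toReal_zero]
      exact hη0
  · -- stopped and short: the counter advances, the state stays good
    dsimp only at hflag hS hshort
    subst hflag
    rw [loopStep_stopped, PMF.toOuterMeasure_pure_apply, if_neg, ENNReal.toReal_zero]
    · exact hη0
    · exact fun h => h (Or.inr ⟨rfl, hS, hshort⟩)

/-! ### The counter and the output after `T + 1` rounds -/

omit [MeasurableSpace V] [BorelSpace V] in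
/-- Every round advances the counter by one. [folklore] -/
theorem fst_eq_of_mem_support_loopStep (β : ℝ) (k₀ : ℕ) (st : ℕ × Bool × (Fin n → Λ))
    {st' : ℕ × Bool × (Fin n → Λ)} (h : st' ∈ ((loopStep Λ hn q O β k₀) st).support) :
    st'.1 = st.1 + 1 := by
  obtain ⟨k, flag, S⟩ := st
  cases flag
  · rw [loopStep_stopped, PMF.support_pure, Set.mem_singleton_iff] at h
    rw [h]
  · by_cases hS : LinearIndependent ℝ fun j => (S j : V)
    · rw [loopStep_running Λ hn q O β k₀ k S hS, PMF.support_map] at h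
      obtain ⟨o, -, rfl⟩ := h
      cases o <;> rfl
    · rw [loopStep_running_of_not Λ hn q O β k₀ k S hS, PMF.support_pure, Set.mem_singleton_iff] at h
      rw [h]

omit [MeasurableSpace V] [BorelSpace V] in
/-- After `N` rounds the counter reads `N` more. [folklore] -/
theorem fst_eq_of_mem_support_iterate (β : ℝ) (k₀ : ℕ) :
    ∀ (N : ℕ) (μ : PMF (ℕ × Bool × (Fin n → Λ))) (c : ℕ), (∀ st ∈ μ.support, st.1 = c) →
      ∀ st ∈ ((fun ν : PMF (ℕ × Bool × (Fin n → Λ)) => ν.bind (loopStep Λ hn q O β k₀))^[N] μ).support,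
        st.1 = c + N
  | 0, μ, c, hμ, st, hst => by simpa using hμ st hst
  | N + 1, μ, c, hμ, st, hst => by
    rw [Function.iterate_succ_apply] at hst
    have h := fst_eq_of_mem_support_iterate β k₀ N (μ.bind (loopStep Λ hn q O β k₀)) (c + 1)
      (fun st' hst' => by
        rw [PMF.mem_support_bind_iff] at hst'
        obtain ⟨st₀, hst₀, hst'⟩ := hst'
        rw [fst_eq_of_mem_support_loopStep Λ hn q O β k₀ st₀ hst', hμ st₀ hst₀]) st hst
    rw [h]; ring

/-- **The idealised Cor. 5.13 (MR07): the loop of Lemma 5.10 over the amplified idealised `IncGDD`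
solver outputs a short linearly independent set with high probability.** Start from linearly
independent lattice vectors `S₀` (e.g. an LLL-reduced basis), run `T + 1` rounds where
`(3/4)^{T+1} ∏ ‖s₀ⱼ‖ < λⁿ` for a lower bound `λ` on the nonzero vectors of `Λ` (so no run can still
be going), with `q ≥ 8n√m β`, `β ≥ 1`, `0 < ε < 1` and the side condition of Thm. 5.9. Then the
final state is STOPPED with a linearly independent `S ⊂ Λ`, `‖sⱼ‖ ≤ 8β√n · η_ε(Λ)` (a solution of
`GIVP^{η_ε}_{8β√n}`), except with probability at most `(T+1)(1 − p)^{k₀}`,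
`p = (δ/(2βm) − m·2ε/(1+ε))/3`, `δ` the oracle kernel's average-case `SIS_{q,m,β}` success.
(With `δ ≥ 1/nᶜ`, `ε = 2⁻ⁿ` and polynomial `k₀`, `T` this is `≥ 2/3`; the reduction is the one of the
first step of the proof of Thm. 5.23, run on the dual lattice.)
[cite: MicciancioRegev2007, Cor. 5.13 (p. 25) = Lemma 5.10 (p. 24) + Thm. 5.9 (pp. 22–24)] -/
theorem toReal_iterate_loopStep_short_ge {ε β lam : ℝ} (hε : 0 < ε) (hε1 : ε < 1) (hβ : 1 ≤ β)
    (hm : 0 < m) (hn1 : 1 ≤ finrank ℝ V) (hq : 8 * n * Real.sqrt m * β ≤ q)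
    (hnum : 1 / (2 * π) + ε / (1 - ε) + (ε / (1 - ε)) ^ 2 * m ≤ 1 / 6)
    (hlam0 : 0 ≤ lam) (hlam : ∀ v ∈ Λ, v ≠ 0 → lam ≤ ‖v‖)
    (S₀ : Fin n → Λ) (hS₀ : LinearIndependent ℝ fun j => (S₀ j : V)) (T k₀ : ℕ)
    (hT : (3 / 4 : ℝ) ^ (T + 1) * ∏ j, ‖(S₀ j : V)‖ < lam ^ n)
    {p : ℝ} (hp : p = (1 / 3 : ℝ) *
        ((((PMF.uniformOfFintype (Matrix (Fin n) (Fin m) (ZMod q))).bind fun A =>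
            (O A).map (Prod.mk A)).toOuterMeasure {az | IsSolution az.1 β az.2}).toReal / (2 * β * m) -
          m * (2 * ε / (1 + ε)))) :
    1 - (T + 1 : ℝ) * (1 - p) ^ k₀ ≤
      (((fun ν : PMF (ℕ × Bool × (Fin n → Λ)) => ν.bind (loopStep Λ hn q O β k₀))^[T + 1]
          (PMF.pure (0, true, S₀))).toOuterMeasure
        {st | st.2.1 = false ∧ LinearIndependent ℝ (fun j => (st.2.2 j : V)) ∧
          ∀ j, ‖(st.2.2 j : V)‖ ≤ 8 * β * Real.sqrt (finrank ℝ V) * smoothingParameter Λ ε}).toReal := by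
  set P₀ : ℝ := ∏ j, ‖(S₀ j : V)‖ with hP₀
  set μT := (fun ν : PMF (ℕ × Bool × (Fin n → Λ)) => ν.bind (loopStep Λ hn q O β k₀))^[T + 1]
    (PMF.pure (0, true, S₀)) with hμT
  -- the union bound over the rounds
  have hstep := toReal_loopStep_compl_goodState_le Λ hn q O (P₀ := P₀) hε hε1 hβ hm hn1 hq hnum k₀ hp
  have hp1 : 0 ≤ (1 - p) ^ k₀ := by
    have h1 : (((PMF.uniformOfFintype (Matrix (Fin n) (Fin m) (ZMod q))).bind fun A =>
        (O A).map (Prod.mk A)).toOuterMeasure {az | IsSolution az.1 β az.2}).toReal / (2 * β * m) ≤ 1 := by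
      rw [div_le_one (by positivity)]
      have : (1 : ℝ) ≤ m := by exact_mod_cast hm
      nlinarith [PMF.toReal_toOuterMeasure_le_one ((PMF.uniformOfFintype (Matrix (Fin n) (Fin m) (ZMod q))).bind
        fun A => (O A).map (Prod.mk A)) {az | IsSolution az.1 β az.2}]
    have h2 : 0 ≤ (m : ℝ) * (2 * ε / (1 + ε)) := by positivity
    exact pow_nonneg (by rw [hp]; nlinarith) _
  have hiter := PMF.toReal_toOuterMeasure_iterate_compl_pure_le (loopStep Λ hn q O β k₀)
    (goodState Λ β ε P₀) hp1 hstep (T + 1) (s₀ := (0, true, S₀)) (Or.inl ⟨rfl, hS₀, by simp [hP₀]⟩)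
  -- good final states in the support are stopped and short
  have hsupp : goodState Λ β ε P₀ ∩ μT.support ⊆
      {st | st.2.1 = false ∧ LinearIndependent ℝ (fun j => (st.2.2 j : V)) ∧
        ∀ j, ‖(st.2.2 j : V)‖ ≤ 8 * β * Real.sqrt (finrank ℝ V) * smoothingParameter Λ ε} := by
    rintro st ⟨hgood, hmem⟩
    have hcnt : st.1 = 0 + (T + 1) := fst_eq_of_mem_support_iterate Λ hn q O β k₀ (T + 1) _ 0
      (fun st' hst' => by rw [PMF.support_pure, Set.mem_singleton_iff] at hst'; rw [hst']) st hmem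
    rcases hgood with ⟨hflag, hS, hpot⟩ | ⟨hflag, hS, hshort⟩
    · -- still running after `T + 1` rounds contradicts the potential lower bound
      exfalso
      rw [hcnt, zero_add] at hpot
      have hlow : lam ^ n ≤ ∏ j, ‖(st.2.2 j : V)‖ :=
        pow_le_prod_norm (L := (Λ : Set V)) hlam0 hlam (fun j => (st.2.2 j).2) fun j => by
          have := hS.ne_zero j; exact fun h => this h
      linarith
    · exact ⟨hflag, hS, hshort⟩
  calc 1 - (T + 1 : ℝ) * (1 - p) ^ k₀
      ≤ 1 - (μT.toOuterMeasure (goodState Λ β ε P₀)ᶜ).toReal := by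
        have : (μT.toOuterMeasure (goodState Λ β ε P₀)ᶜ).toReal ≤ ((T + 1 : ℕ) : ℝ) * (1 - p) ^ k₀ := hiter
        push_cast at this
        linarith
    _ = (μT.toOuterMeasure (goodState Λ β ε P₀)).toReal := by
        rw [toReal_toOuterMeasure_compl]
        have := toReal_toOuterMeasure_compl μT (goodState Λ β ε P₀)
        linarith
    _ ≤ _ := ENNReal.toReal_mono (PMF.toOuterMeasure_ne_top _ _) (μT.toOuterMeasure_mono hsupp)

end Loop

end MicciancioRegev2007

end Literature.Algebra.EuclideanLattices

end
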